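import Summits.Langlands.Langlands.Theorems.RationalPeriodQuarterTameDecompositionPrelim
import Summits.Langlands.Langlands.Theorems.RationalPeriodQuarterAnalyticCoreZero
import Summits.Langlands.Langlands.Theorems.RationalPeriodQuarterProjectionAlg

/-!
# `RationalPeriodQuarter` — the projected `PR_ℂ` function and the identity-on-open-sets step (child A, lemma L3, prelim)

Support for `RationalPeriodQuarter.HeckeFieldOfCruxes` (stmt-Langlands-10432), seed node `HeckeFieldOfCruxesSplit`,
child A `RationalFormsInjectivity`.  Given a `ℚ`-linear functional `π : ℂ → ℚ` and a `PR_ℂ` function `φ` (route's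
inlined `IsPRC`: complex numerators, RATIONAL denominators, rational break points), `rpqProjFun π φ` is the function
obtained by applying `π` to the numerator coefficients of any two-sided local representation — well defined
(`rpqProjFun_eq`), again `PR_ℂ` with the same break data (`rpqProjFun_isPRC`), and equal to the pointwise projection
`π (φ t)` at rational `t` off the break set (`rpqProjFun_ratCast`).  Plus the continuity/density step
`rpq_identity_on_open` / `rpq_filter_step` used to spread an identity from the rationals to cofinitely all reals.
-/

set_option linter.dupNamespace false

namespace Summit.Langlands.Langlands.Theorems

open scoped BigOperators Topology
open Filter Set Polynomial

/-- `aeval` over `ℚ[X]` at a complex point as `eval` of the mapped polynomial. -/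
theorem rpq_aeval_eq_eval_map (Q : ℚ[X]) (s : ℂ) :
    Polynomial.aeval s Q = (Q.map (algebraMap ℚ ℂ)).eval s := by
  rw [Polynomial.aeval_def, Polynomial.eval_map]

/-- Two-sided representation near a point outside the break set. -/
theorem rpq_rep_nhds (φ : ℝ → ℂ) (F : Finset ℚ)
    (hF : ∀ a b : ℚ, a < b → (∀ r ∈ F, r ≤ a ∨ b ≤ r) →
      ∃ (P : Polynomial ℂ) (Q : Polynomial ℚ), ∀ x : ℝ, (a : ℝ) < x → x < b →
        Polynomial.aeval (x : ℂ) Q ≠ 0 ∧ φ x = Polynomial.eval (x : ℂ) P / Polynomial.aeval (x : ℂ) Q)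
    (x : ℝ) (hx : ∀ r ∈ F, (r : ℝ) ≠ x) :
    ∃ (P : ℂ[X]) (Q : ℚ[X]), ∀ᶠ (t : ℝ) in 𝓝 x,
      Polynomial.aeval (t : ℂ) Q ≠ 0 ∧ φ t = P.eval (t : ℂ) / Polynomial.aeval (t : ℂ) Q := by
  obtain ⟨b, hxb, hbF⟩ := tameDecomp_exists_rat_gt_gap F x
  obtain ⟨a, hax, haF⟩ := tameDecomp_exists_rat_lt_gap F x
  have hab : a < b := by exact_mod_cast hax.trans hxb
  have hgap : ∀ r ∈ F, r ≤ a ∨ b ≤ r := by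
    intro r hr
    rcases haF r hr with h | h
    · exact Or.inl h
    · rcases hbF r hr with h' | h'
      · exact absurd (le_antisymm h' h) (hx r hr)
      · exact Or.inr h'
  obtain ⟨P, Q, hP⟩ := hF a b hab hgap
  exact ⟨P, Q, by filter_upwards [Ioo_mem_nhds hax hxb] with t ht using hP t ht.1 ht.2⟩

/-- The `PR_ℚ` interval clause implies the `PR_ℂ`-shaped interval clause (same break set). -/
theorem rpq_prq_clause (φ : ℝ → ℂ) (F : Finset ℚ)
    (hF : ∀ a b : ℚ, a < b → (∀ r ∈ F, r ≤ a ∨ b ≤ r) →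
      ∃ P Q : Polynomial ℚ, ∀ x : ℝ, (a : ℝ) < x → x < b →
        Polynomial.aeval (x : ℂ) Q ≠ 0 ∧ φ x = Polynomial.aeval (x : ℂ) P / Polynomial.aeval (x : ℂ) Q) :
    ∀ a b : ℚ, a < b → (∀ r ∈ F, r ≤ a ∨ b ≤ r) →
      ∃ (P : Polynomial ℂ) (Q : Polynomial ℚ), ∀ x : ℝ, (a : ℝ) < x → x < b →
        Polynomial.aeval (x : ℂ) Q ≠ 0 ∧ φ x = Polynomial.eval (x : ℂ) P / Polynomial.aeval (x : ℂ) Q := by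
  intro a b hab hgap
  obtain ⟨P, Q, hP⟩ := hF a b hab hgap
  refine ⟨P.map (algebraMap ℚ ℂ), Q, fun x h1 h2 => ?_⟩
  rw [← rpq_aeval_eq_eval_map]
  exact hP x h1 h2

/-- A `PR_ℚ` function takes rational values at rational points outside its break set. -/
theorem rpq_prq_ratCast_value (φ : ℝ → ℂ) (F : Finset ℚ)
    (hF : ∀ a b : ℚ, a < b → (∀ r ∈ F, r ≤ a ∨ b ≤ r) →
      ∃ P Q : Polynomial ℚ, ∀ x : ℝ, (a : ℝ) < x → x < b →
        Polynomial.aeval (x : ℂ) Q ≠ 0 ∧ φ x = Polynomial.aeval (x : ℂ) P / Polynomial.aeval (x : ℂ) Q)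
    (t : ℚ) (ht : t ∉ F) : ∃ r : ℚ, φ (t : ℝ) = (r : ℂ) := by
  obtain ⟨b, hxb, hbF⟩ := tameDecomp_exists_rat_gt_gap F (t : ℝ)
  obtain ⟨a, hax, haF⟩ := tameDecomp_exists_rat_lt_gap F (t : ℝ)
  have hab : a < b := by exact_mod_cast hax.trans hxb
  have hgap : ∀ r ∈ F, r ≤ a ∨ b ≤ r := by
    intro r hr
    rcases haF r hr with h | h
    · exact Or.inl h
    · rcases hbF r hr with h' | h'
      · exfalso
        have h'' : (r : ℝ) = t := le_antisymm h' h
        have : r = t := by exact_mod_cast h''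
        exact ht (this ▸ hr)
      · exact Or.inr h'
  obtain ⟨P, Q, hP⟩ := hF a b hab hgap
  obtain ⟨-, hv⟩ := hP t hax hxb
  refine ⟨P.eval t / Q.eval t, ?_⟩
  rw [hv, Complex.ofReal_ratCast]
  have h1 : (Polynomial.aeval (t : ℂ)) P = ((P.eval t : ℚ) : ℂ) := by
    have := Polynomial.aeval_algebraMap_apply_eq_algebraMap_eval (A := ℂ) t P
    simpa using this
  have h2 : (Polynomial.aeval (t : ℂ)) Q = ((Q.eval t : ℚ) : ℂ) := by
    have := Polynomial.aeval_algebraMap_apply_eq_algebraMap_eval (A := ℂ) t Q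
    simpa using this
  rw [h1, h2, Rat.cast_div]

open Classical in
/-- The projected function: at a point admitting a two-sided representation `P/Q` (`Q` rational), the value of the
projected fraction `(rpqProj π P)/Q`; elsewhere `0`.  Well defined by `rpqProjFun_eq`. -/
noncomputable def rpqProjFun (π : ℂ →ₗ[ℚ] ℚ) (φ : ℝ → ℂ) : ℝ → ℂ := fun t =>
  if h : ∃ PQ : ℂ[X] × ℚ[X], ∀ᶠ (s : ℝ) in 𝓝 t,
      Polynomial.aeval (s : ℂ) PQ.2 ≠ 0 ∧ φ s = PQ.1.eval (s : ℂ) / Polynomial.aeval (s : ℂ) PQ.2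
  then (rpqProj π h.choose.1).eval (t : ℂ) / Polynomial.aeval (t : ℂ) h.choose.2 else 0

/-- WELL-DEFINEDNESS of the projected function: any two-sided representation computes it. -/
theorem rpqProjFun_eq (π : ℂ →ₗ[ℚ] ℚ) (φ : ℝ → ℂ) (t : ℝ) (P : ℂ[X]) (Q : ℚ[X])
    (h : ∀ᶠ (s : ℝ) in 𝓝 t, Polynomial.aeval (s : ℂ) Q ≠ 0 ∧ φ s = P.eval (s : ℂ) / Polynomial.aeval (s : ℂ) Q) :
    rpqProjFun π φ t = (rpqProj π P).eval (t : ℂ) / Polynomial.aeval (t : ℂ) Q := by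
  have hex : ∃ PQ : ℂ[X] × ℚ[X], ∀ᶠ (s : ℝ) in 𝓝 t,
      Polynomial.aeval (s : ℂ) PQ.2 ≠ 0 ∧ φ s = PQ.1.eval (s : ℂ) / Polynomial.aeval (s : ℂ) PQ.2 := ⟨(P, Q), h⟩
  unfold rpqProjFun
  rw [dif_pos hex]
  set P' := hex.choose.1 with hP'
  set Q' := hex.choose.2 with hQ'
  have h' : ∀ᶠ (s : ℝ) in 𝓝 t,
      Polynomial.aeval (s : ℂ) Q' ≠ 0 ∧ φ s = P'.eval (s : ℂ) / Polynomial.aeval (s : ℂ) Q' := hex.choose_spec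
  -- a neighbourhood interval where both representations hold
  obtain ⟨ε, hε, hball⟩ := Metric.eventually_nhds_iff.1 (h.and h')
  have hS : Set.Infinite ((fun s : ℝ => (s : ℂ)) '' Set.Ioo t (t + ε)) :=
    (Set.Ioo_infinite (by linarith)).image Complex.ofReal_injective.injOn
  have key := rpqProj_frac_wellDefined π P' P Q' Q ((fun s : ℝ => (s : ℂ)) '' Set.Ioo t (t + ε)) hS
    (by
      rintro _ ⟨s, hs, rfl⟩
      have hd : dist s t < ε := by
        rw [Real.dist_eq, abs_lt]; constructor <;> linarith [hs.1, hs.2]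
      obtain ⟨⟨hQ, hφ⟩, ⟨hQ'', hφ'⟩⟩ := hball hd
      rw [rpq_aeval_eq_eval_map] at hQ hQ'' hφ hφ'
      exact ⟨hQ'', hQ, by rw [← hφ', ← hφ]⟩)
  -- evaluate the polynomial identity at `t`
  obtain ⟨⟨hQt, -⟩, ⟨hQ't, -⟩⟩ := (h.and h').self_of_nhds
  rw [rpq_aeval_eq_eval_map] at hQt hQ't ⊢
  rw [rpq_aeval_eq_eval_map, div_eq_div_iff hQ't hQt, ← Polynomial.eval_mul, ← Polynomial.eval_mul, key]

/-- On an open set carrying a representation, the projected function is the projected fraction. -/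
theorem rpqProjFun_eq_on (π : ℂ →ₗ[ℚ] ℚ) (φ : ℝ → ℂ) (U : Set ℝ) (hU : IsOpen U) (P : ℂ[X]) (Q : ℚ[X])
    (h : ∀ s ∈ U, Polynomial.aeval (s : ℂ) Q ≠ 0 ∧ φ s = P.eval (s : ℂ) / Polynomial.aeval (s : ℂ) Q)
    (t : ℝ) (ht : t ∈ U) :
    Polynomial.aeval (t : ℂ) Q ≠ 0 ∧ rpqProjFun π φ t = (rpqProj π P).eval (t : ℂ) / Polynomial.aeval (t : ℂ) Q :=
  ⟨(h t ht).1, rpqProjFun_eq π φ t P Q (by filter_upwards [hU.mem_nhds ht] with s hs using h s hs)⟩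

/-- The projected function of a `PR_ℂ` function is `PR_ℂ` (same break set and tail bound, projected numerators). -/
theorem rpqProjFun_isPRC (π : ℂ →ₗ[ℚ] ℚ) (φ : ℝ → ℂ)
    (hφ : ∃ F : Finset ℚ, (∀ a b : ℚ, a < b → (∀ r ∈ F, r ≤ a ∨ b ≤ r) → ∃ (P : Polynomial ℂ) (Q : Polynomial ℚ), ∀ x : ℝ, (a : ℝ) < x → x < b → Polynomial.aeval (x : ℂ) Q ≠ 0 ∧ φ x = Polynomial.eval (x : ℂ) P / Polynomial.aeval (x : ℂ) Q) ∧ ∃ B : ℚ, (∃ (P : Polynomial ℂ) (Q : Polynomial ℚ), ∀ x : ℝ, (B : ℝ) < x → Polynomial.aeval (x : ℂ) Q ≠ 0 ∧ φ x = Polynomial.eval (x : ℂ) P / Polynomial.aeval (x : ℂ) Q) ∧ (∃ (P : Polynomial ℂ) (Q : Polynomial ℚ), ∀ x : ℝ, x < -(B : ℝ) → Polynomial.aeval (x : ℂ) Q ≠ 0 ∧ φ x = Polynomial.eval (x : ℂ) P / Polynomial.aeval (x : ℂ) Q)) :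
    ∃ F : Finset ℚ, (∀ a b : ℚ, a < b → (∀ r ∈ F, r ≤ a ∨ b ≤ r) → ∃ (P : Polynomial ℂ) (Q : Polynomial ℚ), ∀ x : ℝ, (a : ℝ) < x → x < b → Polynomial.aeval (x : ℂ) Q ≠ 0 ∧ rpqProjFun π φ x = Polynomial.eval (x : ℂ) P / Polynomial.aeval (x : ℂ) Q) ∧ ∃ B : ℚ, (∃ (P : Polynomial ℂ) (Q : Polynomial ℚ), ∀ x : ℝ, (B : ℝ) < x → Polynomial.aeval (x : ℂ) Q ≠ 0 ∧ rpqProjFun π φ x = Polynomial.eval (x : ℂ) P / Polynomial.aeval (x : ℂ) Q) ∧ (∃ (P : Polynomial ℂ) (Q : Polynomial ℚ), ∀ x : ℝ, x < -(B : ℝ) → Polynomial.aeval (x : ℂ) Q ≠ 0 ∧ rpqProjFun π φ x = Polynomial.eval (x : ℂ) P / Polynomial.aeval (x : ℂ) Q) := by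
  obtain ⟨F, hF, B, ⟨P₁, Q₁, h₁⟩, ⟨P₂, Q₂, h₂⟩⟩ := hφ
  refine ⟨F, fun a b hab hgap => ?_, B, ⟨rpqProj π P₁, Q₁, fun x hx => ?_⟩, ⟨rpqProj π P₂, Q₂, fun x hx => ?_⟩⟩
  · obtain ⟨P, Q, hP⟩ := hF a b hab hgap
    exact ⟨rpqProj π P, Q, fun x h1 h2 =>
      rpqProjFun_eq_on π φ (Set.Ioo (a : ℝ) b) isOpen_Ioo P Q (fun s hs => hP s hs.1 hs.2) x ⟨h1, h2⟩⟩
  · exact rpqProjFun_eq_on π φ (Set.Ioi (B : ℝ)) isOpen_Ioi P₁ Q₁ (fun s hs => h₁ s hs) x hx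
  · exact rpqProjFun_eq_on π φ (Set.Iio (-(B : ℝ))) isOpen_Iio P₂ Q₂ (fun s hs => h₂ s hs) x hx

/-- At a rational point outside the break set, the projected function is the pointwise projection of the value. -/
theorem rpqProjFun_ratCast (π : ℂ →ₗ[ℚ] ℚ) (φ : ℝ → ℂ) (F : Finset ℚ)
    (hF : ∀ a b : ℚ, a < b → (∀ r ∈ F, r ≤ a ∨ b ≤ r) →
      ∃ (P : Polynomial ℂ) (Q : Polynomial ℚ), ∀ x : ℝ, (a : ℝ) < x → x < b →
        Polynomial.aeval (x : ℂ) Q ≠ 0 ∧ φ x = Polynomial.eval (x : ℂ) P / Polynomial.aeval (x : ℂ) Q)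
    (t : ℚ) (ht : t ∉ F) : ((π (φ (t : ℝ)) : ℚ) : ℂ) = rpqProjFun π φ (t : ℝ) := by
  have hx : ∀ r ∈ F, (r : ℝ) ≠ (t : ℝ) := by
    intro r hr h
    have : r = t := by exact_mod_cast h
    exact ht (this ▸ hr)
  obtain ⟨P, Q, hPQ⟩ := rpq_rep_nhds φ F hF (t : ℝ) hx
  rw [rpqProjFun_eq π φ (t : ℝ) P Q hPQ]
  obtain ⟨-, hv⟩ := hPQ.self_of_nhds
  rw [hv, Complex.ofReal_ratCast]
  have h2 : (Polynomial.aeval (t : ℂ)) Q = ((Q.eval t : ℚ) : ℂ) := by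
    have := Polynomial.aeval_algebraMap_apply_eq_algebraMap_eval (A := ℂ) t Q
    simpa using this
  rw [h2, rpqProj_eval_div_ratCast]

/-- IDENTITY ON AN OPEN SET.  If `k`, `ρπ` and `ρπ ∘ m` (`m` a real Möbius map, pole-free on `U`) are single
fractions on the open set `U`, and the coboundary identity holds on `U ∩ D` with `D` dense, it holds on `U`. -/
theorem rpq_identity_on_open (U D : Set ℝ) (hU : IsOpen U) (hD : Dense D) (k ρπ : ℝ → ℂ) (a b c d : ℝ)
    (A B P₁ Q₁ P₂ Q₂ : ℂ[X])
    (hk : ∀ t ∈ U, B.eval (t : ℂ) ≠ 0 ∧ k t = A.eval (t : ℂ) / B.eval (t : ℂ))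
    (h1 : ∀ t ∈ U, Q₁.eval (t : ℂ) ≠ 0 ∧ ρπ t = P₁.eval (t : ℂ) / Q₁.eval (t : ℂ))
    (hcd : ∀ t ∈ U, c * t + d ≠ 0)
    (h2 : ∀ t ∈ U, Q₂.eval (((a * t + b) / (c * t + d) : ℝ) : ℂ) ≠ 0 ∧
      ρπ ((a * t + b) / (c * t + d)) =
        P₂.eval (((a * t + b) / (c * t + d) : ℝ) : ℂ) / Q₂.eval (((a * t + b) / (c * t + d) : ℝ) : ℂ))
    (hid : ∀ t ∈ U ∩ D, k t = ρπ t - ((|c * t + d|⁻¹ : ℝ) : ℂ) * ρπ ((a * t + b) / (c * t + d))) :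
    ∀ t ∈ U, k t = ρπ t - ((|c * t + d|⁻¹ : ℝ) : ℂ) * ρπ ((a * t + b) / (c * t + d)) := by
  set ψ : ℝ → ℂ := fun t => A.eval (t : ℂ) / B.eval (t : ℂ) - (P₁.eval (t : ℂ) / Q₁.eval (t : ℂ) -
    ((|c * t + d|⁻¹ : ℝ) : ℂ) * (P₂.eval (((a * t + b) / (c * t + d) : ℝ) : ℂ) /
      Q₂.eval (((a * t + b) / (c * t + d) : ℝ) : ℂ))) with hψ
  have hevC : ∀ P : ℂ[X], Continuous fun t : ℝ => P.eval (t : ℂ) := fun P =>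
    P.continuous.comp Complex.continuous_ofReal
  have hcont : ∀ y ∈ U, ContinuousAt ψ y := by
    intro y hy
    have hm : ContinuousAt (fun t : ℝ => (a * t + b) / (c * t + d)) y :=
      ((continuous_const.mul continuous_id).add continuous_const).continuousAt.div
        ((continuous_const.mul continuous_id).add continuous_const).continuousAt (hcd y hy)
    have hP₂ : ContinuousAt (fun t : ℝ => P₂.eval (((a * t + b) / (c * t + d) : ℝ) : ℂ)) y :=
      (hevC P₂).continuousAt.comp hm
    have hQ₂ : ContinuousAt (fun t : ℝ => Q₂.eval (((a * t + b) / (c * t + d) : ℝ) : ℂ)) y :=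
      (hevC Q₂).continuousAt.comp hm
    have habs : ContinuousAt (fun t : ℝ => ((|c * t + d|⁻¹ : ℝ) : ℂ)) y :=
      Complex.continuous_ofReal.continuousAt.comp
        ((continuous_abs.comp ((continuous_const.mul continuous_id).add continuous_const)).continuousAt.inv₀
          (abs_ne_zero.2 (hcd y hy)))
    exact ((hevC A).continuousAt.div (hevC B).continuousAt (hk y hy).1).sub
      (((hevC P₁).continuousAt.div (hevC Q₁).continuousAt (h1 y hy).1).sub
        (habs.mul (hP₂.div hQ₂ (h2 y hy).1)))
  have h0 : ∀ t ∈ U ∩ D, ψ t = 0 := by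
    intro t ht
    have e := hid t ht
    rw [(hk t ht.1).2, (h1 t ht.1).2, (h2 t ht.1).2] at e
    simp only [hψ, e, sub_self]
  intro t ht
  have hz := anCore_zero_of_dense ψ U D hU hD hcont h0 t ht
  rw [(hk t ht).2, (h1 t ht).2, (h2 t ht).2]
  have hz' : A.eval (t : ℂ) / B.eval (t : ℂ) - (P₁.eval (t : ℂ) / Q₁.eval (t : ℂ) -
    ((|c * t + d|⁻¹ : ℝ) : ℂ) * (P₂.eval (((a * t + b) / (c * t + d) : ℝ) : ℂ) /
      Q₂.eval (((a * t + b) / (c * t + d) : ℝ) : ℂ))) = 0 := hz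
  exact sub_eq_zero.1 hz' 

/-- FILTER STEP.  In a filter `L` generated by open sets (one-sided neighbourhoods, `atTop`, `atBot`), eventual
single-fraction data for `k`, `ρπ`, `ρπ ∘ m` plus the identity on a dense set give the identity eventually. -/
theorem rpq_filter_step (L : Filter ℝ) (hL : ∀ s ∈ L, ∃ U : Set ℝ, IsOpen U ∧ U ∈ L ∧ U ⊆ s)
    (D : Set ℝ) (hD : Dense D) (k ρπ : ℝ → ℂ) (a b c d : ℝ) (A B P₁ Q₁ P₂ Q₂ : ℂ[X])
    (hk : ∀ᶠ (t : ℝ) in L, B.eval (t : ℂ) ≠ 0 ∧ k t = A.eval (t : ℂ) / B.eval (t : ℂ))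
    (h1 : ∀ᶠ (t : ℝ) in L, Q₁.eval (t : ℂ) ≠ 0 ∧ ρπ t = P₁.eval (t : ℂ) / Q₁.eval (t : ℂ))
    (hcd : ∀ᶠ (t : ℝ) in L, c * t + d ≠ 0)
    (h2 : ∀ᶠ (t : ℝ) in L, Q₂.eval (((a * t + b) / (c * t + d) : ℝ) : ℂ) ≠ 0 ∧
      ρπ ((a * t + b) / (c * t + d)) =
        P₂.eval (((a * t + b) / (c * t + d) : ℝ) : ℂ) / Q₂.eval (((a * t + b) / (c * t + d) : ℝ) : ℂ))
    (hid : ∀ t ∈ D, k t = ρπ t - ((|c * t + d|⁻¹ : ℝ) : ℂ) * ρπ ((a * t + b) / (c * t + d))) :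
    ∀ᶠ (t : ℝ) in L, k t = ρπ t - ((|c * t + d|⁻¹ : ℝ) : ℂ) * ρπ ((a * t + b) / (c * t + d)) := by
  obtain ⟨U, hUo, hUL, hUs⟩ := hL _ (((hk.and h1).and hcd).and h2)
  have := rpq_identity_on_open U D hUo hD k ρπ a b c d A B P₁ Q₁ P₂ Q₂
    (fun t ht => (hUs ht).1.1.1) (fun t ht => (hUs ht).1.1.2) (fun t ht => (hUs ht).1.2)
    (fun t ht => (hUs ht).2) (fun t ht => hid t ht.2)
  exact Filter.mem_of_superset hUL fun t ht => this t ht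

/-- `𝓝[>] x` is generated by open sets. -/
theorem rpq_gen_nhdsGT (x : ℝ) : ∀ s ∈ 𝓝[>] x, ∃ U : Set ℝ, IsOpen U ∧ U ∈ 𝓝[>] x ∧ U ⊆ s := by
  intro s hs
  obtain ⟨u, hu, hsub⟩ := mem_nhdsGT_iff_exists_Ioo_subset.1 hs
  exact ⟨Set.Ioo x u, isOpen_Ioo, Ioo_mem_nhdsGT hu, hsub⟩

/-- `𝓝[<] x` is generated by open sets. -/
theorem rpq_gen_nhdsLT (x : ℝ) : ∀ s ∈ 𝓝[<] x, ∃ U : Set ℝ, IsOpen U ∧ U ∈ 𝓝[<] x ∧ U ⊆ s := by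
  intro s hs
  obtain ⟨l, hl, hsub⟩ := mem_nhdsLT_iff_exists_Ioo_subset.1 hs
  exact ⟨Set.Ioo l x, isOpen_Ioo, Ioo_mem_nhdsLT hl, hsub⟩

/-- `atTop` on `ℝ` is generated by open sets. -/
theorem rpq_gen_atTop : ∀ s ∈ (atTop : Filter ℝ), ∃ U : Set ℝ, IsOpen U ∧ U ∈ atTop ∧ U ⊆ s := by
  intro s hs
  obtain ⟨R, hR⟩ := mem_atTop_sets.1 hs
  exact ⟨Set.Ioi R, isOpen_Ioi, Ioi_mem_atTop R, fun t ht => hR t (le_of_lt ht)⟩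

/-- `atBot` on `ℝ` is generated by open sets. -/
theorem rpq_gen_atBot : ∀ s ∈ (atBot : Filter ℝ), ∃ U : Set ℝ, IsOpen U ∧ U ∈ atBot ∧ U ⊆ s := by
  intro s hs
  obtain ⟨R, hR⟩ := mem_atBot_sets.1 hs
  exact ⟨Set.Iio R, isOpen_Iio, Iio_mem_atBot R, fun t ht => hR t (le_of_lt ht)⟩

end Summit.Langlands.Langlands.Theorems
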